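import Literature.AlgebraicGeometry.Frobenioids.BirationalTower
import Literature.AlgebraicGeometry.Frobenioids.BaseDegSquareProp311
import Literature.AlgebraicGeometry.Frobenioids.UnitTrivializationIsFrobenioid
import Literature.AlgebraicGeometry.Frobenioids.UnitEquivalenceProofs
import Literature.AlgebraicGeometry.Frobenioids.DivisorMonoidCategoryTheoreticityProofs
import Literature.AlgebraicGeometry.Frobenioids.DivisorMonoidBirationalTypesProofs
import Literature.AlgebraicGeometry.Frobenioids.BirationalizationBaseIsoTransport
import HarnessLib

/-!
# Frobenioids I, Corollary 4.12 — ASSEMBLY of the birational tower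
# `C_i → C_i^birat → (C_i^birat)^un-tr ⥲ F_{0_{D_i}} = D_i × N_{≥1}` from its pieces

Mochizuki, *The geometry of Frobenioids I: the general theory*, Kyushu J. Math. **62** (2008)
293–400, kurims text, proof of Cor. 4.12 p. 95 ll. 18–40 [cite: MochizukiFrdI2008, Cor. 4.12 p.95]:
"the natural projection functors `C_i → F_{0_{D_i}}` may be identified with the natural functors
`C_i → C_i^birat → (C_i^birat)^un-tr` [cf. Proposition 3.11, (i)] … Corollary 4.12 follows by applying
Corollary 4.10 to pass from `C_i` to `C_i^birat` …, followed by Theorem 3.4, (iv) …, which allows us to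
pass from `C_i^birat` to `(C_i^birat)^un-tr`".

PROOF-ONLY (cell sub-DAG W9 = `HOME/staging/w5/w5-d222/SUBDAG-FrdI-Cor412.md`, rows C412-L07–L10a;
seat abc-iut-w5-d222). This is the twin, over `F_{0_D} = D × N_{≥1}` (`PreFrobenioidData.toBaseDeg`),
of `BirationalTower.lean` (abc-iut-L1-d6, the base square of Cor. 4.11 (ii) over `D`). For Frobenioids
`C_i → F_{Φ_i}` with THE birationalizations `C_i^birat` (`PreFrobenioid.Birat`, `toBirat`, operations
`biratOps` over `0_{D_i}`; seats abc-iut-L6-t8 / L6-t6) of ISOTROPIC type (print's reduced case, p. 95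
l. 19; Prop. 4.8 (i)), and with the Frobenioid structures `C_i^birat → F_{0_{D_i}}` (Prop. 4.4 (ii),
first sentence — hypotheses `hB_i`, exactly as in `UnitTrivializationFrobeniusCompact.lean`):

* (C412-L09) `PreFrobenioid.Birat.toBirat_comp_toBaseDeg`, `PreFrobenioid.toUntr_comp_toBaseDeg_untr`:
  `C → C^birat` and `C^istr → C^un-tr` lie over `D × N_{≥1}` ON THE NOSE (they preserve bases AND
  Frobenius degrees; Prop. 4.4 (i), Prop. 3.3 (iv));
* (C412-L08) `PreFrobenioid.prop311Setting_untr`: for a Frobenioid over the ZERO monoid on a base of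
  FSMFF-type, THE operations of its unit-trivialization (abc-iut-L1-d5's `untrFunctor`) are in the setting
  of Prop. 3.11 (isotropic, unit-trivial, group-like), whence (`FrdI.Prop311i_holds`,
  `toBaseDeg_isEquivalence_of_prop311i`) `C^un-tr → D × N_{≥1}` is an EQUIVALENCE
  (`PreFrobenioid.toBaseDeg_untr_isEquivalence`);
* (C412-L07/L10a) `PreFrobenioid.exists_toBaseDeg_equivalence_of_birat_pieces`: given an equivalence
  `Ψ^birat : C₁^birat ⥲ C₂^birat` over `Ψ` (Cor. 4.10: `Birat.mapOfEquiv`) whose functor and quasi-inverse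
  preserve `O^×(−)` (Thm. 3.4 (iv) over Frobenius-slim bases — the INPUT, as hypotheses `hunits`,
  `hunits'`), the induced `(Ψ^birat)^un-tr` (`exists_untr_oneUniqueSquare`, abc-iut-L1-d6) and the two
  equivalences of (L08) give `Ψ⁰ : D₁ × N_{≥1} ⥲ D₂ × N_{≥1}` `1`-commuting with `Ψ` over the projections
  ("composing diagrams", `exists_toBaseDeg_equivalence_of_tower`); `PreFrobenioid.cor412_of_birat_pieces`:
  hence the typed Cor. 4.12 (`PreFrobenioidData.Cor412`; `1`-uniqueness `BaseDegSquare`, rigidity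
  Prop. 1.13 (i) — kernel-checked there);
* (C412-L10b) `FrdI.cor412_of_thm34iv`: the typed Cor. 4.12 for `Ψ` from the NAMED FACT [FrdI] Thm. 3.4 (iv)
  (`FrdI.Thm34iv`, `CategoryTheoreticityFacts.lean`; abc-iut FACT-LIST F-0713) applied — exactly where
  print invokes it (p. 95 l. 34) — to `Ψ^birat` on `C_i^birat → F_{0_{D_i}}` over FROBENIUS-SLIM bases,
  `Ψ^birat` being Cor. 4.10's `Birat.mapOfEquiv` (with the quasi-inverse `mapOfEquiv` of `Ψ⁻¹`,
  `Localization.equivalence`), its hypothesis (b) `HypB` = "`Ψ^birat` preserves base-isomorphisms"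
  (`Birat.isBaseIso_mapOfEquiv_map`, abc-iut-L6-t20, from Prop. 4.4 (iv) + the Thm. 3.4 (iii) clause
  `hbi`) and (a) "`C_i^birat` of standard type" (Prop. 4.8 (iii), hypothesis `hstd_i`).

No statement of the paper is restated as a `Prop` or strengthened; nothing here is specific to the abc
programme or bears on [IUTchIII] Cor. 3.12.
-/

namespace Literature.AlgebraicGeometry.Frobenioids

open CategoryTheory Opposite

universe w v v' u u'

namespace PreFrobenioid

section OneFrobenioid

variable {D : Type u} [Category.{v} D] {Φ : Dᵒᵖ ⥤ CommMonCat.{w}}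
  {C : Type u'} [Category.{v'} C] {F : C ⥤ ElemFrobenioid Φ}

/-- **C412-L09 (b)**: the unit-trivialization functor `C^istr → C^un-tr` lies over `F_{0_D}`-coordinates
ON THE NOSE: it preserves bases and Frobenius degrees ([FrdI] Prop. 3.3 (iv) p. 60; used on p. 95
ll. 19–24 "the natural projection functors `C_i → F_{0_{D_i}}` may be identified with …
`→ (C_i^birat)^un-tr`"). [cite: MochizukiFrdI2008, Cor. 4.12 p.95] -/
theorem toUntr_comp_toBaseDeg_untr (hF : IsFrobenioid F) :
    (PreFrobenioidData.ofFunctor Φ F).toUntr ⋙ (PreFrobenioidData.ofFunctor Φ (untrFunctor hF)).toBaseDeg =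
      (PreFrobenioidData.ofFunctor Φ F).istrι ⋙ (PreFrobenioidData.ofFunctor Φ F).toBaseDeg :=
  Functor.hext (fun _ => rfl) fun _ _ α =>
    heq_of_eq (Prod.ext (base_toUntr (hF := hF) α) (degFr_toUntr (hF := hF) α))

/-- **C412-L08**: for a Frobenioid `C → F_Φ` over the ZERO monoid (`Φ(X) = 1` for all `X`) on a base of
FSMFF-type, THE operations of its unit-trivialization `C^un-tr → F_Φ` (abc-iut-L1-d5's `untrFunctor`) are
in the setting of [FrdI] Prop. 3.11: zero monoid, FSMFF base, isotropic, unit-trivial and group-like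
type (p. 95 l. 24 "[cf. Proposition 3.11, (i)]" with p. 94 "the Frobenioids `(C_i^birat)^un-tr` are of
isotropic, unit-trivial, and group-like type"). [cite: MochizukiFrdI2008, Cor. 4.12 p.95] -/
theorem prop311Setting_untr (hF : IsFrobenioid F) (hzero : ∀ (X : D) (x : Φ.obj (op X)), x = 1)
    (hD : IsOfFSMFFType D) :
    PreFrobenioidData.Prop311Setting (PreFrobenioidData.ofFunctor Φ (untrFunctor hF)) where
  zero := hzero
  fsmff := hD
  isotropic := (PreFrobenioidData.ofFunctor_isOfIsotropicType _).2 (isOfIsotropicType_untr hF)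
  unitTrivial := ⟨fun X => (PreFrobenioidData.ofFunctor_isUnitTrivial _ X).2 (isUnitTrivial_untr hF X)⟩
  groupLike := ⟨fun _ x => hzero _ x⟩

/-- **C412-L08, conclusion**: for a Frobenioid over the zero monoid on a base of FSMFF-type, the
projection `C^un-tr → F_{0_D} = D × N_{≥1}` is an EQUIVALENCE — [FrdI] Prop. 3.11 (i) (p. 73;
`FrdI.Prop311i_holds`, abc-iut cell) for the Frobenioid `(C^un-tr → F_{0_D})` (`isFrobenioid_untr`,
abc-iut-L1-d5), turned into an equivalence by `toBaseDeg_isEquivalence_of_prop311i` (abc-iut-L1-d5).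
[cite: MochizukiFrdI2008, Cor. 4.12 p.95] -/
theorem toBaseDeg_untr_isEquivalence (hF : IsFrobenioid F) (hzero : ∀ (X : D) (x : Φ.obj (op X)), x = 1)
    (hD : IsOfFSMFFType D) :
    (PreFrobenioidData.ofFunctor Φ (untrFunctor hF)).toBaseDeg.IsEquivalence :=
  PreFrobenioidData.toBaseDeg_isEquivalence_of_prop311i _ (prop311Setting_untr hF hzero hD)
    (FrdI.Prop311i_holds (untrFunctor hF) (isFrobenioid_untr hF))

variable {hF : IsFrobenioid F} {hsq : HasBiratSquares F}

/-- **C412-L09 (a)**: `C → C^birat` lies over `F_{0_D}`-coordinates ON THE NOSE: it preserves bases and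
Frobenius degrees ([FrdI] Prop. 4.4 (i) p. 83 "the natural functor `C → C^birat` … compatible with the
functors to `D` and Frobenius degrees"; used on p. 95 ll. 19–24). [cite: MochizukiFrdI2008, Cor. 4.12 p.95] -/
theorem Birat.toBirat_comp_toBaseDeg :
    toBirat F hF hsq ⋙ (biratOps hF hsq).toBaseDeg = (PreFrobenioidData.ofFunctor Φ F).toBaseDeg :=
  Functor.hext (fun _ => rfl) fun _ _ φ =>
    heq_of_eq (Prod.ext (biratOps_base_map_toBirat φ) (biratOps_degFr_toBirat φ))

end OneFrobenioid

section TwoFrobenioids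

variable {D₁ : Type u} [Category.{v} D₁] {Φ₁ : D₁ᵒᵖ ⥤ CommMonCat.{w}}
  {C₁ : Type u'} [Category.{v'} C₁] {F₁ : C₁ ⥤ ElemFrobenioid Φ₁}
  {D₂ : Type u} [Category.{v} D₂] {Φ₂ : D₂ᵒᵖ ⥤ CommMonCat.{w}}
  {C₂ : Type u'} [Category.{v'} C₂] {F₂ : C₂ ⥤ ElemFrobenioid Φ₂}

/-- **The square of Cor. 4.12 over `F_{0_{D_i}} = D_i × N_{≥1}` from the birational tower** (FrdI proof
of Cor. 4.12, p. 95 ll. 19–39): given the birationalizations `C_i^birat` of isotropic type with their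
Frobenioid structures `C_i^birat → F_{0_{D_i}}` (Prop. 4.4 (ii)) over bases of FSMFF-type, an equivalence
`Ψ^birat : C₁^birat ⥲ C₂^birat` with `Ψ^birat ∘ (C₁ → C₁^birat) ≅ (C₂ → C₂^birat) ∘ Ψ` (Cor. 4.10) such that
`Ψ^birat` and its quasi-inverse preserve `O^×(−)` (Thm. 3.4 (iv), Frobenius-slim bases), there is an
equivalence `Ψ⁰ : D₁ × N_{≥1} ⥲ D₂ × N_{≥1}` with `(C₂ → F_{0_{D₂}}) ∘ Ψ ≅ Ψ⁰ ∘ (C₁ → F_{0_{D₁}})`: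
`(Ψ^birat)^un-tr` exists by the quotient universal property (p. 68), and `(C_i^birat)^un-tr → F_{0_{D_i}}`
are equivalences by Prop. 3.11 (i). [cite: MochizukiFrdI2008, Cor. 4.12 p.95] -/
theorem exists_toBaseDeg_equivalence_of_birat_pieces (hF₁ : IsFrobenioid F₁) (hsq₁ : HasBiratSquares F₁)
    (hF₂ : IsFrobenioid F₂) (hsq₂ : HasBiratSquares F₂) (Ψ : C₁ ≌ C₂)
    (hB₁ : IsFrobenioid (Birat.toElemZero hF₁ hsq₁)) (hB₂ : IsFrobenioid (Birat.toElemZero hF₂ hsq₂))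
    (hD₁ : IsOfFSMFFType D₁) (hD₂ : IsOfFSMFFType D₂)
    (hiso₁ : (biratOps hF₁ hsq₁).IsOfIsotropicType) (hiso₂ : (biratOps hF₂ hsq₂).IsOfIsotropicType)
    (Eb : Birat F₁ hF₁ hsq₁ ≌ Birat F₂ hF₂ hsq₂)
    (sq : toBirat F₁ hF₁ hsq₁ ⋙ Eb.functor ≅ Ψ.functor ⋙ toBirat F₂ hF₂ hsq₂)
    (hunits : ∀ (X : Birat F₁ hF₁ hsq₁) (u : Aut X), u ∈ (biratOps hF₁ hsq₁).unitsSubgroup X →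
      Eb.functor.mapIso u ∈ (biratOps hF₂ hsq₂).unitsSubgroup (Eb.functor.obj X))
    (hunits' : ∀ (Y : Birat F₂ hF₂ hsq₂) (u : Aut Y), u ∈ (biratOps hF₂ hsq₂).unitsSubgroup Y →
      Eb.inverse.mapIso u ∈ (biratOps hF₁ hsq₁).unitsSubgroup (Eb.inverse.obj Y)) :
    ∃ Ψ0 : D₁ × SingleObj ℕ+ ⥤ D₂ × SingleObj ℕ+, Ψ0.IsEquivalence ∧
      OneCommutes Ψ.functor (PreFrobenioidData.ofFunctor Φ₂ F₂).toBaseDeg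
        (PreFrobenioidData.ofFunctor Φ₁ F₁).toBaseDeg Ψ0 := by
  -- the isotropic objects of `C_i^birat` are all objects
  let P := (biratOps hF₁ hsq₁).isotropicObjects
  let Q := (biratOps hF₂ hsq₂).isotropicObjects
  haveI : Q.IsClosedUnderIsomorphisms := ⟨fun _ _ => hiso₂.obj _⟩
  have hPQ : Q.inverseImage Eb.functor = P := by
    funext X
    exact propext ⟨fun _ => hiso₁.obj X, fun _ => hiso₂.obj _⟩
  -- `Ψ^birat` on the isotropic objects preserves `≈^{O^×}` (C412-L07, first half)
  let G : (biratOps hF₁ hsq₁).Istr ≌ (biratOps hF₂ hsq₂).Istr := Eb.congrFullSubcategory hPQ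
  have hG := PreFrobenioidData.unitEquiv_map_of_units _ _ G.functor fun X δ hδ =>
    ⟨Eb.functor.mapIso δ, hunits X.obj δ hδ, rfl⟩
  have hG' := PreFrobenioidData.unitEquiv_map_of_units _ _ G.inverse fun Y δ hδ =>
    ⟨Eb.inverse.mapIso δ, hunits' Y.obj δ hδ, rfl⟩
  -- `(Ψ^birat)^un-tr` and its square (C412-L07, second half)
  obtain ⟨ΨU, hEqU, hsqU, -⟩ := PreFrobenioidData.exists_untr_oneUniqueSquare _ _ G hG hG'
  haveI := hEqU
  -- THE operations of `(C_i^birat)^un-tr` over `0_{D_i}`; `(C_i^birat)^un-tr ⥲ D_i × N_{≥1}` (C412-L08)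
  let SU₁ := PreFrobenioidData.ofFunctor (zeroMonoid D₁) (untrFunctor hB₁)
  let SU₂ := PreFrobenioidData.ofFunctor (zeroMonoid D₂) (untrFunctor hB₂)
  haveI : SU₁.toBaseDeg.IsEquivalence :=
    toBaseDeg_untr_isEquivalence hB₁ (biratOps_mon_eq_one hF₁ hsq₁) hD₁
  haveI : SU₂.toBaseDeg.IsEquivalence :=
    toBaseDeg_untr_isEquivalence hB₂ (biratOps_mon_eq_one hF₂ hsq₂) hD₂
  -- the functors `C_i → C_i^birat → (C_i^birat)^istr → (C_i^birat)^un-tr`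
  let L₁ : C₁ ⥤ (biratOps hF₁ hsq₁).Istr := P.lift (toBirat F₁ hF₁ hsq₁) fun A => hiso₁.obj _
  let L₂ : C₂ ⥤ (biratOps hF₂ hsq₂).Istr := Q.lift (toBirat F₂ hF₂ hsq₂) fun A => hiso₂.obj _
  -- `C_i → F_{0_{D_i}}` factors through `C_i → (C_i^birat)^un-tr` (C412-L09)
  have ιU₁ : (biratOps hF₁ hsq₁).toUntr ⋙ SU₁.toBaseDeg ≅
      (biratOps hF₁ hsq₁).istrι ⋙ (biratOps hF₁ hsq₁).toBaseDeg :=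
    eqToIso (toUntr_comp_toBaseDeg_untr hB₁)
  have ιU₂ : (biratOps hF₂ hsq₂).toUntr ⋙ SU₂.toBaseDeg ≅
      (biratOps hF₂ hsq₂).istrι ⋙ (biratOps hF₂ hsq₂).toBaseDeg :=
    eqToIso (toUntr_comp_toBaseDeg_untr hB₂)
  have ι₁ : (L₁ ⋙ (biratOps hF₁ hsq₁).toUntr) ⋙ SU₁.toBaseDeg ≅ (PreFrobenioidData.ofFunctor Φ₁ F₁).toBaseDeg :=
    Functor.associator _ _ _ ≪≫ Functor.isoWhiskerLeft L₁ ιU₁ ≪≫ (Functor.associator _ _ _).symm ≪≫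
      Functor.isoWhiskerRight (P.liftCompιIso _ _) _ ≪≫ eqToIso Birat.toBirat_comp_toBaseDeg
  have ι₂ : (L₂ ⋙ (biratOps hF₂ hsq₂).toUntr) ⋙ SU₂.toBaseDeg ≅ (PreFrobenioidData.ofFunctor Φ₂ F₂).toBaseDeg :=
    Functor.associator _ _ _ ≪≫ Functor.isoWhiskerLeft L₂ ιU₂ ≪≫ (Functor.associator _ _ _).symm ≪≫
      Functor.isoWhiskerRight (Q.liftCompιIso _ _) _ ≪≫ eqToIso Birat.toBirat_comp_toBaseDeg
  -- `Ψ` over `C_i → (C_i^birat)^istr`: the square `sq` lifted to the full subcategories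
  have sqI : L₁ ⋙ G.functor ≅ Ψ.functor ⋙ L₂ :=
    (Q.fullyFaithfulι.whiskeringRight C₁).preimageIso sq
  -- `Ψ` over `C_i → (C_i^birat)^un-tr`
  obtain ⟨τ⟩ := hsqU
  have hT : OneCommutes Ψ.functor (L₂ ⋙ (biratOps hF₂ hsq₂).toUntr) (L₁ ⋙ (biratOps hF₁ hsq₁).toUntr)
      ΨU.asEquivalence.functor :=
    ⟨(Functor.associator _ _ _).symm ≪≫ Functor.isoWhiskerRight sqI.symm _ ≪≫ Functor.associator _ _ _ ≪≫
      Functor.isoWhiskerLeft L₁ τ ≪≫ (Functor.associator _ _ _).symm⟩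
  -- "composing diagrams"
  exact PreFrobenioidData.exists_toBaseDeg_equivalence_of_tower _ _ Ψ SU₁ SU₂ _ _ ι₁ ι₂
    ΨU.asEquivalence hT

/-- **Corollary 4.12 from the birational pieces** (FrdI p. 95): under the hypotheses of
`exists_toBaseDeg_equivalence_of_birat_pieces`, the typed Cor. 4.12 (`PreFrobenioidData.Cor412`) holds
for `Ψ`, for all parameters `R_i` — the `1`-uniqueness of `Ψ⁰` ("there exists a 1-unique functor `Ψ⁰`",
`BaseDegSquare`) and the rigidity of the composites for slim bases ("follows from Proposition 1.13,
(i)") being theorems for Frobenioids (`cor412_of_exists_toBaseDeg_equivalence`).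
[cite: MochizukiFrdI2008, Cor. 4.12 p.95] -/
theorem cor412_of_birat_pieces (hF₁ : IsFrobenioid F₁) (hsq₁ : HasBiratSquares F₁)
    (hF₂ : IsFrobenioid F₂) (hsq₂ : HasBiratSquares F₂) (Ψ : C₁ ≌ C₂)
    (hB₁ : IsFrobenioid (Birat.toElemZero hF₁ hsq₁)) (hB₂ : IsFrobenioid (Birat.toElemZero hF₂ hsq₂))
    (hD₁ : IsOfFSMFFType D₁) (hD₂ : IsOfFSMFFType D₂)
    (hiso₁ : (biratOps hF₁ hsq₁).IsOfIsotropicType) (hiso₂ : (biratOps hF₂ hsq₂).IsOfIsotropicType)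
    (Eb : Birat F₁ hF₁ hsq₁ ≌ Birat F₂ hF₂ hsq₂)
    (sq : toBirat F₁ hF₁ hsq₁ ⋙ Eb.functor ≅ Ψ.functor ⋙ toBirat F₂ hF₂ hsq₂)
    (hunits : ∀ (X : Birat F₁ hF₁ hsq₁) (u : Aut X), u ∈ (biratOps hF₁ hsq₁).unitsSubgroup X →
      Eb.functor.mapIso u ∈ (biratOps hF₂ hsq₂).unitsSubgroup (Eb.functor.obj X))
    (hunits' : ∀ (Y : Birat F₂ hF₂ hsq₂) (u : Aut Y), u ∈ (biratOps hF₂ hsq₂).unitsSubgroup Y →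
      Eb.inverse.mapIso u ∈ (biratOps hF₁ hsq₁).unitsSubgroup (Eb.inverse.obj Y))
    (R₁ : (PreFrobenioidData.ofFunctor Φ₁ F₁).RSParams) (R₂ : (PreFrobenioidData.ofFunctor Φ₂ F₂).RSParams) :
    (PreFrobenioidData.ofFunctor Φ₁ F₁).Cor412 (PreFrobenioidData.ofFunctor Φ₂ F₂) Ψ R₁ R₂ :=
  PreFrobenioidData.cor412_of_exists_toBaseDeg_equivalence _ _ Ψ R₁ R₂ (exists_base_iso_of_isFrobenioid F₁ hF₁)
    (exists_linear_preSteps_of_base_iso F₁ hF₁) (fun A _ f => exists_linear_arrow_over_base F₁ hF₁ A f)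
    (exists_baseIso_of_degFr F₁ hF₁)
    (exists_toBaseDeg_equivalence_of_birat_pieces hF₁ hsq₁ hF₂ hsq₂ Ψ hB₁ hB₂ hD₁ hD₂ hiso₁ hiso₂ Eb sq
      hunits hunits')
    (fun _ h₂ => IsRigidFunctor.comp_of_isEquivalence Ψ.functor (isRigidFunctor_baseFunctor hF₂ h₂))

end TwoFrobenioids

end PreFrobenioid

namespace FrdI

open PreFrobenioid

variable {D₁ : Type u} [Category.{v} D₁] {Φ₁ : D₁ᵒᵖ ⥤ CommMonCat.{w}}
  {C₁ : Type u'} [Category.{v'} C₁] {F₁ : C₁ ⥤ ElemFrobenioid Φ₁}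
  {D₂ : Type u} [Category.{v} D₂] {Φ₂ : D₂ᵒᵖ ⥤ CommMonCat.{w}}
  {C₂ : Type u'} [Category.{v'} C₂] {F₂ : C₂ ⥤ ElemFrobenioid Φ₂}

/-- **[FrdI] Corollary 4.12 from the named fact Theorem 3.4 (iv)** (C412-L10b; print p. 95 ll. 30–39:
"Corollary 4.12 follows by applying Corollary 4.10 to pass from `C_i` to `C_i^birat` [where we note that,
by Proposition 4.4, (iv), and Theorem 3.4, (iii), … `Ψ^birat` preserves base-isomorphisms], followed by
Theorem 3.4, (iv) [where we note that, by Proposition 4.8, (iii), `C_i^birat` is of standard type]"), in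
print's reduced case "`C₁, C₂` of isotropic type" (p. 95 l. 19): for Frobenioids `C_i → F_{Φ_i}` of
isotropic type with THE birationalizations carrying their Frobenioid structures `C_i^birat → F_{0_{D_i}}`
(Prop. 4.4 (ii), `hB_i`) of standard type (Prop. 4.8 (iii), `hstd_i`), over Frobenius-slim bases (the
hypothesis of Cor. 4.12), such that `Ψ`, `Ψ⁻¹` preserve co-angular pre-steps (Thm. 3.4 (ii), `hΨ`, `hΨ'`:
the input of Cor. 4.10) and base-isomorphisms (Thm. 3.4 (iii), `hbi`, `hbi'`), the typed Cor. 4.12 holds —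
GIVEN the named fact `FrdI.Thm34iv` (at the universes of the birationalizations), whose clause
"`Ψ` preserves `O^×(−)`" supplies the units of `Ψ^birat` and of its quasi-inverse.
[cite: MochizukiFrdI2008, Cor. 4.12 p.95] -/
theorem cor412_of_thm34iv (h34iv : Thm34iv.{w, v, max u' v', u, u'})
    (hF₁ : IsFrobenioid F₁) (hsq₁ : HasBiratSquares F₁) (hF₂ : IsFrobenioid F₂) (hsq₂ : HasBiratSquares F₂)
    (Ψ : C₁ ≌ C₂)
    (hB₁ : IsFrobenioid (Birat.toElemZero hF₁ hsq₁)) (hB₂ : IsFrobenioid (Birat.toElemZero hF₂ hsq₂))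
    (hC₁ : (PreFrobenioidData.ofFunctor Φ₁ F₁).IsOfIsotropicType)
    (hC₂ : (PreFrobenioidData.ofFunctor Φ₂ F₂).IsOfIsotropicType)
    (hstd₁ : (biratOps hF₁ hsq₁).IsOfStandardType) (hstd₂ : (biratOps hF₂ hsq₂).IsOfStandardType)
    (hfs₁ : IsFrobeniusSlim D₁) (hfs₂ : IsFrobeniusSlim D₂)
    (hΨ : ∀ ⦃A B : C₁⦄ (f : A ⟶ B), IsCoAngularPreStep F₁ f → IsCoAngularPreStep F₂ (Ψ.functor.map f))
    (hΨ' : ∀ ⦃A B : C₂⦄ (f : A ⟶ B), IsCoAngularPreStep F₂ f → IsCoAngularPreStep F₁ (Ψ.inverse.map f))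
    (hbi : PreFrobenioidData.PreservesMor Ψ.functor (PreFrobenioidData.ofFunctor Φ₁ F₁).IsBaseIso
      (PreFrobenioidData.ofFunctor Φ₂ F₂).IsBaseIso)
    (hbi' : PreFrobenioidData.PreservesMor Ψ.inverse (PreFrobenioidData.ofFunctor Φ₂ F₂).IsBaseIso
      (PreFrobenioidData.ofFunctor Φ₁ F₁).IsBaseIso)
    (R₁ : (PreFrobenioidData.ofFunctor Φ₁ F₁).RSParams) (R₂ : (PreFrobenioidData.ofFunctor Φ₂ F₂).RSParams) :
    (PreFrobenioidData.ofFunctor Φ₁ F₁).Cor412 (PreFrobenioidData.ofFunctor Φ₂ F₂) Ψ R₁ R₂ := by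
  -- `Ψ^birat` (Cor. 4.10) as an equivalence with functor `mapOfEquiv Ψ` and inverse `mapOfEquiv Ψ⁻¹`
  haveI := toBirat_isLocalization hF₁ hsq₁
  haveI := toBirat_isLocalization hF₂ hsq₂
  letI := Birat.liftingMapOfEquiv hF₁ hsq₁ hF₂ hsq₂ Ψ hΨ
  let F' : Birat F₂ hF₂ hsq₂ ⥤ Birat F₁ hF₁ hsq₁ := Birat.mapOfEquiv hF₂ hsq₂ hF₁ hsq₁ Ψ.symm hΨ'
  let fac' : toBirat F₂ hF₂ hsq₂ ⋙ F' ≅ Ψ.inverse ⋙ toBirat F₁ hF₁ hsq₁ :=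
    Birat.mapOfEquivFac hF₂ hsq₂ hF₁ hsq₁ Ψ.symm hΨ'
  letI : Localization.Lifting (toBirat F₂ hF₂ hsq₂) (coAngularPreSteps F₂)
      (Ψ.inverse ⋙ toBirat F₁ hF₁ hsq₁) F' := ⟨fac'⟩
  let α : (Ψ.functor ⋙ toBirat F₂ hF₂ hsq₂) ⋙ F' ≅ toBirat F₁ hF₁ hsq₁ :=
    Functor.associator _ _ _ ≪≫ Functor.isoWhiskerLeft Ψ.functor fac' ≪≫
      (Functor.associator _ _ _).symm ≪≫ Functor.isoWhiskerRight Ψ.unitIso.symm _ ≪≫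
        Functor.leftUnitor _
  let β : (Ψ.inverse ⋙ toBirat F₁ hF₁ hsq₁) ⋙ Birat.mapOfEquiv hF₁ hsq₁ hF₂ hsq₂ Ψ hΨ ≅
      toBirat F₂ hF₂ hsq₂ :=
    Functor.associator _ _ _ ≪≫
      Functor.isoWhiskerLeft Ψ.inverse (Birat.mapOfEquivFac hF₁ hsq₁ hF₂ hsq₂ Ψ hΨ) ≪≫
        (Functor.associator _ _ _).symm ≪≫ Functor.isoWhiskerRight Ψ.counitIso _ ≪≫
          Functor.leftUnitor _
  let Eb : Birat F₁ hF₁ hsq₁ ≌ Birat F₂ hF₂ hsq₂ :=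
    Localization.equivalence (toBirat F₁ hF₁ hsq₁) (coAngularPreSteps F₁) (toBirat F₂ hF₂ hsq₂)
      (coAngularPreSteps F₂) (Ψ.functor ⋙ toBirat F₂ hF₂ hsq₂) (Birat.mapOfEquiv hF₁ hsq₁ hF₂ hsq₂ Ψ hΨ)
      (Ψ.inverse ⋙ toBirat F₁ hF₁ hsq₁) F' α β
  -- (b) for `Ψ^birat`: base-isomorphisms are preserved (Prop. 4.4 (iv) + Thm. 3.4 (iii); abc-iut-L6-t20)
  have hpres : PreFrobenioidData.PreservesMor Eb.functor (biratOps hF₁ hsq₁).IsBaseIso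
      (biratOps hF₂ hsq₂).IsBaseIso :=
    fun X Y g hg => Birat.isBaseIso_mapOfEquiv_map hF₁ hsq₁ hF₂ hsq₂ Ψ hΨ hbi g hg
  have hpres' : PreFrobenioidData.PreservesMor Eb.inverse (biratOps hF₂ hsq₂).IsBaseIso
      (biratOps hF₁ hsq₁).IsBaseIso :=
    fun X Y g hg => Birat.isBaseIso_mapOfEquiv_map hF₂ hsq₂ hF₁ hsq₁ Ψ.symm hΨ' hbi' g hg
  have hHypB : (biratOps hF₁ hsq₁).HypB (biratOps hF₂ hsq₂) Eb := fun _ _ => ⟨hpres, hpres'⟩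
  have hHypB' : (biratOps hF₂ hsq₂).HypB (biratOps hF₁ hsq₁) Eb.symm := fun _ _ => ⟨hpres', hpres⟩
  -- Thm. 3.4 (iv) for `Ψ^birat` and for its quasi-inverse: `O^×(−)` is preserved
  obtain ⟨-, hu, -⟩ := h34iv (Birat.toElemZero hF₁ hsq₁) (Birat.toElemZero hF₂ hsq₂) hB₁ hB₂ Eb
    hstd₁ hstd₂ hHypB hfs₁ hfs₂
  obtain ⟨-, hu', -⟩ := h34iv (Birat.toElemZero hF₂ hsq₂) (Birat.toElemZero hF₁ hsq₁) hB₂ hB₁ Eb.symm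
    hstd₂ hstd₁ hHypB' hfs₂ hfs₁
  exact cor412_of_birat_pieces hF₁ hsq₁ hF₂ hsq₂ Ψ hB₁ hB₂ hstd₁.fsmff hstd₂.fsmff
    (PreFrobenioidData.isOfIsotropicType_ofFunctor_toElemZero hF₁ hsq₁ hC₁)
    (PreFrobenioidData.isOfIsotropicType_ofFunctor_toElemZero hF₂ hsq₂ hC₂) Eb
    (Birat.mapOfEquivFac hF₁ hsq₁ hF₂ hsq₂ Ψ hΨ) hu hu' R₁ R₂

end FrdI

end Literature.AlgebraicGeometry.Frobenioids
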